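import Mathlib
import HarnessLib
import Summits.PneNP.PneNP.Theses.KrwChromaticSteering
import Summits.PneNP.PneNP.Theorems.KrwChromaticSteeringCompositionIterationKW
import Summits.PneNP.PneNP.Theorems.KrwChromaticSteeringCompositionIterationCVP
import Summits.PneNP.PneNP.Theorems.KrwChromaticSteeringCompositionIterationIterate
import Literature.Computability.Complexity.KRWComposition
import Literature.Computability.Complexity.ConstantDepth
import Literature.Computability.Complexity.Classes
import Literature.Computability.Complexity.CircuitClassesProofs

/-!
# `CompositionIteration` (item stmt-PneNP-18541, route `KrwChromaticSteering`): weak KRW ⇒ P ⊄ NC¹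

The PRINTED glue of the route (Karchmer–Raz–Wigderson 1995, §5 Thm. 7–8; Meir 2023, §1 Prop. 1,
"folklore"): the weak KRW conjecture in depth form with loss `c·(⌊log₂(mn)⌋+1)` — inlined as the
HYPOTHESIS of the route decl, an open conjecture never asserted here — yields a language in `P`
outside non-uniform `NC¹`. This file closes the item BY NAME
(`CompositionIteration_proof : Summit.PneNP.PneNP.Theses.KrwChromaticSteering.CompositionIteration`)
by composing the three landed support files of the birth skeleton
(`Cruxes/CompositionIteration/Lines/birth.lean`):

* `…CompositionIterationIterate`: `exists_hard_function_of_weakKRW` — from weak KRW, for every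
  `c₀` a function `h` on `N` bits with a `B₂`-circuit `C`, `⌊log₂(N+|C|)⌋ ≤ 4S`, whose KW game needs
  depth `> c₀ S` (the KRW iteration with truth-table-sized inner functions);
* `…CompositionIterationCVP`: `stub_cvp` — `L := CircEval.EvalLang ∈ P` and every `B₂`-circuit is a
  projection of a slice of `L` at a length `ℓ` with `⌊log₂ ℓ⌋ ≤ c₂(⌊log₂(N+|C|)⌋+1)`;
* `…CompositionIterationKW`: `exists_solves_of_computes` — Karchmer–Wigderson, a `B₂`-circuit of
  `acDepth D` gives a protocol of depth `≤ 3D`.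

If `L ∈ NC¹`, the `NC¹` circuit deciding the slice of `L` at length `ℓ` becomes a protocol of depth
`≤ 3(c·⌊log₂ ℓ⌋ + c)`, which pulls back along the projection (`KWTree.comap`, same depth) to a
protocol for `h` of depth `≤ c₀ S` at `c₀ := 12·c·c₂ + 3·c·c₂ + 3·c` — contradicting `> c₀ S`.
Honest framing: this is a CONDITIONAL glue step (weak KRW is open); nothing here bears on P vs NP
beyond the printed implication; `P ≠ NP` is not proved.
-/

set_option linter.dupNamespace false -- `Summit.PneNP.PneNP.…`: summit = sub-problem name (D-0017 single-conjunct layout)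

namespace Summit.PneNP.PneNP.Theorems

open Literature.Computability.Complexity
open Summit.PneNP.PneNP.Theorems.KrwCompositionIteration

/-- **Weak KRW (depth form) ⇒ `P ⊄ NC¹`** — the route decl `CompositionIteration` of
`KrwChromaticSteering`, proved: given the conjecture (hypothesis), `L := CircEval.EvalLang ∈ P` is
not in `NC1`, since an `NC¹` family for `L` would give, through Karchmer–Wigderson and the CVP
projection, protocols of depth `O(S)` for the iterated compositions whose KW games need depth
`> c₀ S` for every `c₀`. -/
theorem CompositionIteration_proof :
    Summit.PneNP.PneNP.Theses.KrwChromaticSteering.CompositionIteration := by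
  unfold Summit.PneNP.PneNP.Theses.KrwChromaticSteering.CompositionIteration
  rintro ⟨c, hweak⟩
  obtain ⟨L, hLP, c₂, hCVP⟩ := stub_cvp
  refine ⟨L, hLP, fun hLNC => ?_⟩
  -- unpack `L ∈ NC¹`: a `B₂` family of `acDepth ≤ c'·⌊log₂ n⌋ + c'` deciding `L`
  simp only [NC1, NC, DepthSizeClass, Set.mem_setOf_eq] at hLNC
  obtain ⟨c', p, Cf, hCf, hdec⟩ := hLNC
  -- the iteration, at a constant `c₀` the upper bounds below cannot beat
  set c₀ : ℕ := 3 * c' * c₂ * 4 + 3 * c' * c₂ + 3 * c' with hc₀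
  obtain ⟨N, hN, h, C, hCO, hCc, S, hS1, hSlog, hdeep⟩ := exists_hard_function_of_weakKRW hweak c₀
  -- the hard function is a projection of the slice of `L` at length `ℓ`
  obtain ⟨ℓ, hℓ, hℓlog, e, back, he, hback⟩ := hCVP N hN C hCO
  -- the `NC¹` circuit at length `ℓ` computes that slice and becomes a protocol (Karchmer–Wigderson)
  have hcomp : (Cf ℓ).Computes (L.sliceFn ℓ) := fun x => hdec.eval_eq x
  obtain ⟨P, hP, hPd⟩ := exists_solves_of_computes hℓ (Cf ℓ) (L.sliceFn ℓ) (hCf ℓ).1 hcomp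
  -- pulled back along the projection: a protocol for `h` of the same depth
  have hQ : (P.comap e e back).Solves h :=
    solves_comap_of_embedding hP e back (fun x => (he x).trans (hCc x)) hback
  have hlt : c₀ * S < P.depth := by
    have := hdeep (P.comap e e back) hQ
    rwa [KWTree.depth_comap] at this
  -- the upper bound `P.depth ≤ c₀ * S`
  have hdepth : (Cf ℓ).acDepth ≤ c' * Nat.log 2 ℓ + c' := by
    have := (hCf ℓ).2.1
    simpa using this
  have hlog : Nat.log 2 ℓ ≤ c₂ * (4 * S + 1) :=
    hℓlog.trans (Nat.mul_le_mul_left c₂ (Nat.add_le_add_right hSlog 1))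
  have hup : P.depth ≤ 3 * (c' * (c₂ * (4 * S + 1)) + c') :=
    calc P.depth ≤ 3 * (Cf ℓ).acDepth := hPd
      _ ≤ 3 * (c' * Nat.log 2 ℓ + c') := Nat.mul_le_mul_left 3 hdepth
      _ ≤ 3 * (c' * (c₂ * (4 * S + 1)) + c') :=
          Nat.mul_le_mul_left 3 (Nat.add_le_add_right (Nat.mul_le_mul_left c' hlog) c')
  have hkey : 3 * (c' * (c₂ * (4 * S + 1)) + c') ≤ c₀ * S := by
    have e1 : 3 * (c' * (c₂ * (4 * S + 1)) + c')
        = (3 * c' * c₂ * 4) * S + (3 * c' * c₂ + 3 * c') * 1 := by ring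
    have e2 : c₀ * S = (3 * c' * c₂ * 4) * S + (3 * c' * c₂ + 3 * c') * S := by
      rw [hc₀]; ring
    rw [e1, e2]
    exact Nat.add_le_add_left (Nat.mul_le_mul_left _ hS1) _
  exact absurd (lt_of_lt_of_le hlt (hup.trans hkey)) (lt_irrefl _)

end Summit.PneNP.PneNP.Theorems
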